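import Literature.Analysis.FluidPDE.RieszPressureModConst
import Literature.Analysis.SingularIntegrals.HormanderGradient
import HarnessLib

/-!
# The `log` translation modulus of `D²Γ∞` and the logarithmic growth of the Riesz pressure of a
# bounded field modulo constants (Seregin 2014, Lemma 6.5: `q_F ∈ BMO`)

Analysis/FluidPDE proofs file (all results proved; no definitions, no named facts). Companion of
`RieszPressureModConstKernel` / `RieszPressureModConst`, which build the Riesz pressure
`RᵢRⱼ(vᵢvⱼ)` of a merely **bounded** `C²` field modulo constants,
`pressurePotentialMod x₀ v = −Q₁[v] − farPotentialMod 1 2 x₀ v`, and prove the growth bound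
`|Q̃(x) − Q̃(x')| ≤ 2 N_G ‖Γ₀‖₁ + A N² √(1+|x−x'|)` from the `L¹` translation modulus
`∫ ‖D²Γ∞(z+d) − D²Γ∞(z)‖ dz ≤ A √(1+|d|)` of the far kernel (their docstrings record that "the
sharp order is `log |d|`, a `BMO` statement"). This file proves the sharp order:

* (private helper) polar coordinates: `∫_{|z|<R} (1+|z|)⁻³ dz ≤ 3|B₁| log(1+R)`;
* `RieszPressureModConst.exists_integral_norm_fderiv2_newtonFar_translate_sub_le_log` — the
  **`log` translation modulus** `∫ ‖D²Γ∞(z+d) − D²Γ∞(z)‖ dz ≤ A (1 + log(1+|d|))`: on the far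
  region `|z| ≥ 2(1+|d|)` the mean value inequality with `‖D³Γ∞‖ ≤ M (1+|z|)⁻⁴` and the radial
  tail `∫_{|z|≥s} |z|⁻⁴ = 3|B₁|/s` (Hörmander's gradient condition, Stein 1970 Ch. II §2.2 — the
  tree's `integral_compl_ball_norm_rpow_neg`); on the near region each term separately with
  `‖D²Γ∞‖ ≤ M (1+|z|)⁻³` and the first bullet;
* `exists_abs_farPotentialMod_le_log`, `exists_abs_pressurePotentialMod_sub_le_log` — hence
  `|Q̃(x) − Q̃(x')| ≤ 2 N_G ‖Γ₀‖₁ + A N² (1 + log(1+|x−x'|))` for every bounded continuous field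
  (`|v| ≤ N`) with bounded quadratic source (`|∂ᵢ∂ⱼ(vᵢvⱼ)| ≤ N_G`): the quantitative shadow of
  `p_{u⊗u} ∈ BMO` (Seregin 2014, Lemma 6.5 `‖q_F‖_BMO ≤ c‖F‖_∞`; Def. 6.3) that the pressure of a
  mild bounded ancient solution grows at most logarithmically.

USE: the discharge of `MildAncientPressureLogGrowth` (`MildBoundedAncientPressureBMO.lean`).

## References

* G. Seregin, *Lecture Notes on Regularity Theory for the Navier–Stokes Equations*, World
  Scientific 2014, §6.2 Lemma 6.5, §6.3 Def. 6.3. [Seregin2014]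
* E. M. Stein, *Singular integrals and differentiability properties of functions* (1970),
  Ch. II §2.2 (the gradient condition implies Hörmander's condition). [Stein1971]
* D. Gilbarg, N. S. Trudinger, *Elliptic PDE of Second Order* (2001), (2.14), Lemma 4.2.
  [GilbargTrudinger2001]

## Mathlib / tree search

Tree: `exists_integral_norm_fderiv2_newtonFar_translate_sub_le` (integrability and the `√`
bound), `exists_hasDecay_fderiv_newtonFar`, `exists_hasDecay_four_fderiv3_newtonFar`,
`abs_farPotentialMod_le_modulus`, `farPotentialMod_sub_farPotentialMod`, `abs_nearPotential_le`,
`Literature.Analysis.SingularIntegrals.integral_compl_ball_norm_rpow_neg`,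
`integrableOn_compl_ball_norm_rpow_neg`. Mathlib: `integral_fun_norm_addHaar`,
`integral_add_compl`, `integral_add_right_eq_self`, `integral_inv_of_pos`,
`intervalIntegral.integral_comp_add_left`.
-/

noncomputable section

open MeasureTheory Set Filter Metric Topology InnerProductSpace Function
open scoped RealInnerProductSpace ContDiff ENNReal

namespace Literature.Analysis.FluidPDE

namespace RieszPressureModConst

open Literature.Analysis.FluidPDE.FourierNS (HasDecay)
open Literature.Analysis.FluidPDE.PineauVicol2026
open Literature.Analysis.SingularIntegrals

-- nested operator types `ℝ³ →L[ℝ] ℝ³ →L[ℝ] ℝ³ →L[ℝ] ℝ`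
set_option maxSynthPendingDepth 3

/-- `dim ℝ³ = 3` (bookkeeping for the polar-coordinate and radial-tail lemmas). (private helper). [folklore] -/
private theorem finrank_euclideanSpace_fin_three : Module.finrank ℝ (EuclideanSpace ℝ (Fin 3)) = 3 :=
  finrank_euclideanSpace_fin

/-! ### Polar coordinates: `∫_{|z|<R} (1+|z|)⁻³ ≤ 3|B₁| log(1+R)` -/

/-- The one-dimensional integral behind the near region: `∫₀ᴿ y²(1+y)⁻³ dy ≤ log(1+R)`
(`y² ≤ (1+y)²` and `∫₀ᴿ (1+y)⁻¹ dy = log(1+R)`). [folklore] -/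
private theorem setIntegral_Ioo_sq_mul_inv_one_add_pow_three_le {R : ℝ} (hR : 0 < R) :
    ∫ y in Ioo 0 R, y ^ 2 * ((1 + y) ^ 3)⁻¹ ≤ Real.log (1 + R) := by
  have hcont₁ : ContinuousOn (fun y : ℝ => y ^ 2 * ((1 + y) ^ 3)⁻¹) (Icc 0 R) := by
    refine (continuousOn_pow 2).mul (((continuousOn_const.add continuousOn_id).pow 3).inv₀ ?_)
    intro y hy
    have : 0 < 1 + y := by linarith [hy.1]
    exact pow_ne_zero 3 this.ne'
  have hcont₂ : ContinuousOn (fun y : ℝ => (1 + y)⁻¹) (Icc 0 R) := by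
    refine (continuousOn_const.add continuousOn_id).inv₀ ?_
    intro y hy
    have : 0 < 1 + y := by linarith [hy.1]
    exact this.ne'
  have hi₁ : IntegrableOn (fun y : ℝ => y ^ 2 * ((1 + y) ^ 3)⁻¹) (Ioo 0 R) :=
    (hcont₁.integrableOn_Icc).mono_set Ioo_subset_Icc_self
  have hi₂ : IntegrableOn (fun y : ℝ => (1 + y)⁻¹) (Ioo 0 R) :=
    (hcont₂.integrableOn_Icc).mono_set Ioo_subset_Icc_self
  have hle : ∫ y in Ioo 0 R, y ^ 2 * ((1 + y) ^ 3)⁻¹ ≤ ∫ y in Ioo 0 R, (1 + y)⁻¹ := by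
    refine setIntegral_mono_on hi₁ hi₂ measurableSet_Ioo fun y hy => ?_
    have h1 : 0 < 1 + y := by linarith [hy.1]
    have h3 : 0 < (1 + y) ^ 3 := pow_pos h1 3
    rw [← div_eq_mul_inv, ← one_div, div_le_div_iff₀ h3 h1]
    nlinarith [hy.1, sq_nonneg y]
  refine hle.trans (le_of_eq ?_)
  -- `∫_{(0,R)} (1+y)⁻¹ = ∫₁^{1+R} u⁻¹ du = log(1+R)`
  rw [← integral_Ioc_eq_integral_Ioo, ← intervalIntegral.integral_of_le hR.le]
  have h := intervalIntegral.integral_comp_add_left (fun u : ℝ => u⁻¹) (1 : ℝ) (a := 0) (b := R)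
  rw [h, integral_inv_of_pos (by norm_num) (by linarith), add_zero, div_one]

/-- **Near-region weight in polar coordinates**: `∫_{|z|<R} (1+|z|)⁻³ dz ≤ 3 |B₁| log(1+R)` on
`ℝ³` (`∫ f(|z|) dz = 3|B₁| ∫₀^∞ y² f(y) dy`). [folklore] -/
private theorem setIntegral_ball_inv_one_add_norm_pow_three_le {R : ℝ} (hR : 0 < R) :
    ∫ z in ball (0 : EuclideanSpace ℝ (Fin 3)) R, ((1 + ‖z‖) ^ 3)⁻¹ ≤
      3 * volume.real (ball (0 : EuclideanSpace ℝ (Fin 3)) 1) * Real.log (1 + R) := by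
  haveI : Nontrivial (EuclideanSpace ℝ (Fin 3)) :=
    Module.nontrivial_of_finrank_pos (R := ℝ) (by rw [finrank_euclideanSpace_fin_three]; norm_num)
  set F : ℝ → ℝ := (Iio R).indicator fun y => ((1 + y) ^ 3)⁻¹ with hF
  have h1 : ∫ z in ball (0 : EuclideanSpace ℝ (Fin 3)) R, ((1 + ‖z‖) ^ 3)⁻¹ =
      ∫ z : EuclideanSpace ℝ (Fin 3), F ‖z‖ := by
    rw [← integral_indicator measurableSet_ball]
    congr 1
    funext z
    by_cases hz : z ∈ ball (0 : EuclideanSpace ℝ (Fin 3)) R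
    · have : ‖z‖ ∈ Iio R := by simpa using hz
      rw [indicator_of_mem hz, hF, indicator_of_mem this]
    · have : ‖z‖ ∉ Iio R := by simpa using hz
      rw [indicator_of_notMem hz, hF, indicator_of_notMem this]
  rw [h1, integral_fun_norm_addHaar, finrank_euclideanSpace_fin_three]
  simp only [nsmul_eq_mul, smul_eq_mul, Nat.cast_ofNat]
  -- the radial integral
  have hrad : ∫ y in Ioi (0 : ℝ), y ^ (3 - 1) * F y = ∫ y in Ioo 0 R, y ^ 2 * ((1 + y) ^ 3)⁻¹ := by
    have e : (fun y : ℝ => y ^ (3 - 1) * F y) =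
        (Iio R).indicator fun y => y ^ 2 * ((1 + y) ^ 3)⁻¹ := by
      funext y
      rw [hF]
      by_cases hy : y ∈ Iio R
      · simp [indicator_of_mem hy]
      · simp [indicator_of_notMem hy]
    rw [e, setIntegral_indicator measurableSet_Iio, Ioi_inter_Iio]
  rw [hrad]
  have hB : 0 ≤ volume.real (ball (0 : EuclideanSpace ℝ (Fin 3)) 1) := measureReal_nonneg
  have hJ := setIntegral_Ioo_sq_mul_inv_one_add_pow_three_le hR
  calc (3 : ℝ) * (volume.real (ball (0 : EuclideanSpace ℝ (Fin 3)) 1) *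
        ∫ y in Ioo 0 R, y ^ 2 * ((1 + y) ^ 3)⁻¹)
      ≤ 3 * (volume.real (ball (0 : EuclideanSpace ℝ (Fin 3)) 1) * Real.log (1 + R)) := by
        gcongr
    _ = 3 * volume.real (ball (0 : EuclideanSpace ℝ (Fin 3)) 1) * Real.log (1 + R) := by ring

/-- Translated balls: `∫_{|z|<s} (1+|z+d|)⁻³ dz ≤ ∫_{|w|<s+|d|} (1+|w|)⁻³ dw` (substitute
`w = z + d`, `B(d, s) ⊆ B(0, s+|d|)`). [folklore] -/
private theorem setIntegral_ball_inv_one_add_norm_add_pow_three_le (s : ℝ)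
    (d : EuclideanSpace ℝ (Fin 3)) :
    ∫ z in ball (0 : EuclideanSpace ℝ (Fin 3)) s, ((1 + ‖z + d‖) ^ 3)⁻¹ ≤
      ∫ w in ball (0 : EuclideanSpace ℝ (Fin 3)) (s + ‖d‖), ((1 + ‖w‖) ^ 3)⁻¹ := by
  set f : EuclideanSpace ℝ (Fin 3) → ℝ := fun w => ((1 + ‖w‖) ^ 3)⁻¹ with hf
  have hfc : Continuous f := by
    refine ((continuous_const.add continuous_norm).pow 3).inv₀ fun w => ?_
    have : 0 < 1 + ‖w‖ := by positivity
    exact pow_ne_zero 3 this.ne'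
  have hf0 : ∀ w, 0 ≤ f w := fun w => by simp only [hf]; positivity
  have hfi : ∀ r : ℝ, IntegrableOn f (ball (0 : EuclideanSpace ℝ (Fin 3)) r) := fun r =>
    (hfc.continuousOn.integrableOn_compact (isCompact_closedBall (0 : EuclideanSpace ℝ (Fin 3)) r)).mono_set
      ball_subset_closedBall
  -- `∫_{B(0,s)} f(z+d) dz = ∫ G(z+d) dz` with `G = 𝟙_{B(d,s)} f`
  set G : EuclideanSpace ℝ (Fin 3) → ℝ := (ball d s).indicator f with hG
  have hind : (ball (0 : EuclideanSpace ℝ (Fin 3)) s).indicator (fun z => f (z + d)) =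
      fun z => G (z + d) := by
    funext z
    by_cases hz : z ∈ ball (0 : EuclideanSpace ℝ (Fin 3)) s
    · have hz' : z + d ∈ ball d s := by
        rw [mem_ball, dist_eq_norm, add_sub_cancel_right]; rwa [mem_ball_zero_iff] at hz
      rw [indicator_of_mem hz, hG, indicator_of_mem hz']
    · have hz' : z + d ∉ ball d s := by
        rw [mem_ball, dist_eq_norm, add_sub_cancel_right]; rwa [mem_ball_zero_iff] at hz
      rw [indicator_of_notMem hz, hG, indicator_of_notMem hz']
  have hsub : ball d s ⊆ ball (0 : EuclideanSpace ℝ (Fin 3)) (s + ‖d‖) := by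
    intro w hw
    rw [mem_ball, dist_eq_norm] at hw
    rw [mem_ball_zero_iff]
    calc ‖w‖ = ‖(w - d) + d‖ := by rw [sub_add_cancel]
      _ ≤ ‖w - d‖ + ‖d‖ := norm_add_le _ _
      _ < s + ‖d‖ := by linarith
  calc ∫ z in ball (0 : EuclideanSpace ℝ (Fin 3)) s, f (z + d)
      = ∫ z, (ball (0 : EuclideanSpace ℝ (Fin 3)) s).indicator (fun z => f (z + d)) z :=
        (integral_indicator measurableSet_ball).symm
    _ = ∫ z, G (z + d) := by rw [hind]
    _ = ∫ w, G w := integral_add_right_eq_self G d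
    _ = ∫ w in ball d s, f w := integral_indicator measurableSet_ball
    _ ≤ ∫ w in ball (0 : EuclideanSpace ℝ (Fin 3)) (s + ‖d‖), f w :=
        setIntegral_mono_set (hfi _) (Eventually.of_forall hf0) (Eventually.of_forall hsub)

/-! ### The `log` translation modulus of `D²Γ∞` -/

/-- **The `L¹` translation modulus of `D²Γ∞` is logarithmic**: there is `A ≥ 0` (cutoff radii
only) with `∫ ‖D²Γ∞(z+d) − D²Γ∞(z)‖ dz ≤ A (1 + log(1+|d|))` for every `d ∈ ℝ³`. Far region
`|z| ≥ 2(1+|d|)`: the mean value inequality on `B̄(z,|d|)` (where `1+|ξ| ≥ (1+|z|)/2`) with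
`‖D³Γ∞‖ ≤ M₃ (1+|·|)⁻⁴` gives `16 M₃ |d| (1+|z|)⁻⁴ ≤ 16 M₃ |d| |z|⁻⁴`, and
`∫_{|z|≥s} |z|⁻⁴ dz = 3|B₁|/s` (Stein 1970, Ch. II §2.2: the gradient condition implies
Hörmander's condition); near region: `‖D²Γ∞‖ ≤ M₂ (1+|·|)⁻³` on `B(0,s)` and on its translate,
each `≤ 3|B₁| log(1 + 3(1+|d|))`. The kernel of `RᵢRⱼ` on bounded data is a `BMO` object
(Seregin 2014, Lemma 6.5). [cite: Stein1971, Ch. II §2.2 (2) ⇒ (2'); Seregin2014, §6.2 Lemma 6.5] -/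
theorem exists_integral_norm_fderiv2_newtonFar_translate_sub_le_log {r₀ r₁ : ℝ} (h₀ : 0 < r₀)
    (h₁ : r₀ < r₁) :
    ∃ A, 0 ≤ A ∧ ∀ d : EuclideanSpace ℝ (Fin 3),
      ∫ z, ‖fderiv ℝ (fderiv ℝ (newtonFar r₀ r₁)) (z + d) - fderiv ℝ (fderiv ℝ (newtonFar r₀ r₁)) z‖ ≤
        A * (1 + Real.log (1 + ‖d‖)) := by
  set K := fderiv ℝ (fderiv ℝ (newtonFar r₀ r₁)) with hK
  obtain ⟨⟨M₂, hM₂⟩, -, -⟩ := exists_hasDecay_fderiv_newtonFar h₀ h₁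
  obtain ⟨M₃, hM₃⟩ := exists_hasDecay_four_fderiv3_newtonFar h₀ h₁
  obtain ⟨A₀, -, hA₀⟩ := exists_integral_norm_fderiv2_newtonFar_translate_sub_le h₀ h₁
  have hM₂0 : 0 ≤ M₂ := hM₂.nonneg
  have hM₃0 : 0 ≤ M₃ := hM₃.nonneg
  have hKd : Differentiable ℝ K := (contDiff_fderiv2_newtonFar h₀ h₁).differentiable two_ne_zero
  haveI : Nontrivial (EuclideanSpace ℝ (Fin 3)) :=
    Module.nontrivial_of_finrank_pos (R := ℝ) (by rw [finrank_euclideanSpace_fin_three]; norm_num)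
  set B : ℝ := volume.real (ball (0 : EuclideanSpace ℝ (Fin 3)) 1) with hB
  have hB0 : 0 ≤ B := measureReal_nonneg
  refine ⟨48 * M₃ * B + 12 * M₂ * B, by positivity, fun d => ?_⟩
  have hint : Integrable (fun z => ‖K (z + d) - K z‖) := (hA₀ d).1
  have hd0 : 0 ≤ ‖d‖ := norm_nonneg d
  set s : ℝ := 2 * (1 + ‖d‖) with hs
  have hs0 : 0 < s := by rw [hs]; positivity
  set L : ℝ := Real.log (1 + ‖d‖) with hL
  have hL0 : 0 ≤ L := Real.log_nonneg (by linarith)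
  -- `log (3(1+|d|)) ≤ 2 + L`
  have hlog3 : Real.log (3 * (1 + ‖d‖)) ≤ 2 + L := by
    rw [Real.log_mul (by norm_num) (by positivity), hL]
    have : Real.log 3 ≤ 3 - 1 := Real.log_le_sub_one_of_pos (by norm_num)
    linarith
  -- ### far region `|z| ≥ s`
  have hfar_pt : ∀ z ∈ (ball (0 : EuclideanSpace ℝ (Fin 3)) s)ᶜ,
      ‖K (z + d) - K z‖ ≤ 16 * M₃ * ‖d‖ * ‖z‖ ^ (-(4 : ℝ)) := by
    intro z hz
    rw [mem_compl_iff, mem_ball_zero_iff, not_lt] at hz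
    have hzpos : 0 < ‖z‖ := hs0.trans_le hz
    have hfar : ∀ ξ ∈ closedBall z ‖d‖, ‖fderiv ℝ K ξ‖ ≤ 16 * M₃ * ((1 + ‖z‖) ^ 4)⁻¹ := by
      intro ξ hξ
      rw [mem_closedBall, dist_eq_norm] at hξ
      have hξn : (1 + ‖z‖) / 2 ≤ 1 + ‖ξ‖ := by
        have : ‖z‖ ≤ ‖ξ‖ + ‖ξ - z‖ := by
          have := norm_add_le ξ (z - ξ); rw [add_sub_cancel] at this
          rwa [norm_sub_rev] at this
        rw [hs] at hz
        linarith
      have hpow : ((1 + ‖z‖) / 2) ^ 4 ≤ (1 + ‖ξ‖) ^ 4 := pow_le_pow_left₀ (by positivity) hξn 4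
      calc ‖fderiv ℝ K ξ‖ ≤ M₃ * ((1 + ‖ξ‖) ^ 4)⁻¹ := hM₃ ξ
        _ ≤ M₃ * (((1 + ‖z‖) / 2) ^ 4)⁻¹ := by
            refine mul_le_mul_of_nonneg_left ?_ hM₃0
            exact inv_anti₀ (by positivity) hpow
        _ = 16 * M₃ * ((1 + ‖z‖) ^ 4)⁻¹ := by field_simp; ring
    have hmv := (convex_closedBall z ‖d‖).norm_image_sub_le_of_norm_fderiv_le
      (fun ξ _ => hKd ξ) hfar (mem_closedBall_self (norm_nonneg d))
      (show z + d ∈ closedBall z ‖d‖ by simp [mem_closedBall, dist_eq_norm])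
    rw [add_sub_cancel_left] at hmv
    have hstep : ((1 + ‖z‖) ^ 4)⁻¹ ≤ ‖z‖ ^ (-(4 : ℝ)) := by
      rw [Real.rpow_neg hzpos.le, show (4 : ℝ) = ((4 : ℕ) : ℝ) by norm_num, Real.rpow_natCast]
      exact inv_anti₀ (pow_pos hzpos 4) (pow_le_pow_left₀ hzpos.le (by linarith) 4)
    calc ‖K (z + d) - K z‖ ≤ 16 * M₃ * ((1 + ‖z‖) ^ 4)⁻¹ * ‖d‖ := hmv
      _ = 16 * M₃ * ‖d‖ * ((1 + ‖z‖) ^ 4)⁻¹ := by ring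
      _ ≤ 16 * M₃ * ‖d‖ * ‖z‖ ^ (-(4 : ℝ)) := mul_le_mul_of_nonneg_left hstep (by positivity)
  have hfar : ∫ z in (ball (0 : EuclideanSpace ℝ (Fin 3)) s)ᶜ, ‖K (z + d) - K z‖ ≤ 48 * M₃ * B := by
    have h3 : (Module.finrank ℝ (EuclideanSpace ℝ (Fin 3)) : ℝ) < 4 := by
      rw [finrank_euclideanSpace_fin_three]; norm_num
    have h1 : 1 ≤ Module.finrank ℝ (EuclideanSpace ℝ (Fin 3)) := by
      rw [finrank_euclideanSpace_fin_three]; norm_num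
    have htail_int := integrableOn_compl_ball_norm_rpow_neg (volume : Measure (EuclideanSpace ℝ (Fin 3)))
      h1 h3 hs0
    have htail := integral_compl_ball_norm_rpow_neg (volume : Measure (EuclideanSpace ℝ (Fin 3)))
      h1 h3 hs0
    rw [finrank_euclideanSpace_fin_three] at htail
    have htail' : ∫ z in (ball (0 : EuclideanSpace ℝ (Fin 3)) s)ᶜ, ‖z‖ ^ (-(4 : ℝ)) = 3 * B * s⁻¹ := by
      rw [htail, hB]
      have : (s : ℝ) ^ (((3 : ℕ) : ℝ) - 4) = s⁻¹ := by
        rw [show (((3 : ℕ) : ℝ) - 4) = -1 by norm_num, Real.rpow_neg_one]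
      rw [this]
      norm_num
    calc ∫ z in (ball (0 : EuclideanSpace ℝ (Fin 3)) s)ᶜ, ‖K (z + d) - K z‖
        ≤ ∫ z in (ball (0 : EuclideanSpace ℝ (Fin 3)) s)ᶜ, 16 * M₃ * ‖d‖ * ‖z‖ ^ (-(4 : ℝ)) :=
          setIntegral_mono_on hint.integrableOn (htail_int.const_mul _) measurableSet_ball.compl
            hfar_pt
      _ = 16 * M₃ * ‖d‖ * (3 * B * s⁻¹) := by rw [integral_const_mul, htail']
      _ = 48 * M₃ * B * (‖d‖ * s⁻¹) := by ring
      _ ≤ 48 * M₃ * B * 1 := by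
          refine mul_le_mul_of_nonneg_left ?_ (by positivity)
          rw [← div_eq_mul_inv, div_le_one hs0, hs]
          linarith
      _ = 48 * M₃ * B := mul_one _
  -- ### near region `|z| < s`
  have hnear_w : ∀ R : ℝ, 0 < R →
      IntegrableOn (fun z : EuclideanSpace ℝ (Fin 3) => ((1 + ‖z‖) ^ 3)⁻¹) (ball 0 R) := by
    intro R _
    have hfc : Continuous fun z : EuclideanSpace ℝ (Fin 3) => ((1 + ‖z‖) ^ 3)⁻¹ := by
      refine ((continuous_const.add continuous_norm).pow 3).inv₀ fun w => ?_
      have : 0 < 1 + ‖w‖ := by positivity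
      exact pow_ne_zero 3 this.ne'
    exact (hfc.continuousOn.integrableOn_compact (isCompact_closedBall _ R)).mono_set
      ball_subset_closedBall
  have hnear_w' : IntegrableOn (fun z : EuclideanSpace ℝ (Fin 3) => ((1 + ‖z + d‖) ^ 3)⁻¹) (ball 0 s) := by
    have hfc : Continuous fun z : EuclideanSpace ℝ (Fin 3) => ((1 + ‖z + d‖) ^ 3)⁻¹ := by
      refine ((continuous_const.add (continuous_norm.comp (continuous_id.add continuous_const))).pow
        3).inv₀ fun w => ?_
      have : 0 < 1 + ‖w + d‖ := by positivity
      exact pow_ne_zero 3 this.ne'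
    exact (hfc.continuousOn.integrableOn_compact (isCompact_closedBall _ s)).mono_set
      ball_subset_closedBall
  have hnear : ∫ z in ball (0 : EuclideanSpace ℝ (Fin 3)) s, ‖K (z + d) - K z‖ ≤
      6 * M₂ * B * (2 + L) := by
    have hpt : ∀ z ∈ ball (0 : EuclideanSpace ℝ (Fin 3)) s, ‖K (z + d) - K z‖ ≤
        M₂ * ((1 + ‖z + d‖) ^ 3)⁻¹ + M₂ * ((1 + ‖z‖) ^ 3)⁻¹ := fun z _ =>
      (norm_sub_le _ _).trans (add_le_add (hM₂ _) (hM₂ _))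
    have i1 := setIntegral_ball_inv_one_add_norm_add_pow_three_le s d
    have i2 := setIntegral_ball_inv_one_add_norm_pow_three_le (R := s + ‖d‖) (by positivity)
    have i3 := setIntegral_ball_inv_one_add_norm_pow_three_le hs0
    have l1 : Real.log (1 + (s + ‖d‖)) ≤ 2 + L := by
      rw [show 1 + (s + ‖d‖) = 3 * (1 + ‖d‖) by rw [hs]; ring]; exact hlog3
    have l2 : Real.log (1 + s) ≤ 2 + L := by
      refine (Real.log_le_log (by positivity) ?_).trans hlog3
      rw [hs]; linarith
    calc ∫ z in ball (0 : EuclideanSpace ℝ (Fin 3)) s, ‖K (z + d) - K z‖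
        ≤ ∫ z in ball (0 : EuclideanSpace ℝ (Fin 3)) s,
            (M₂ * ((1 + ‖z + d‖) ^ 3)⁻¹ + M₂ * ((1 + ‖z‖) ^ 3)⁻¹) :=
          setIntegral_mono_on hint.integrableOn ((hnear_w'.const_mul _).add ((hnear_w s hs0).const_mul _))
            measurableSet_ball hpt
      _ = M₂ * (∫ z in ball (0 : EuclideanSpace ℝ (Fin 3)) s, ((1 + ‖z + d‖) ^ 3)⁻¹) +
            M₂ * (∫ z in ball (0 : EuclideanSpace ℝ (Fin 3)) s, ((1 + ‖z‖) ^ 3)⁻¹) := by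
          rw [integral_add (hnear_w'.const_mul _) ((hnear_w s hs0).const_mul _), integral_const_mul,
            integral_const_mul]
      _ ≤ M₂ * (3 * B * Real.log (1 + (s + ‖d‖))) + M₂ * (3 * B * Real.log (1 + s)) :=
          add_le_add (mul_le_mul_of_nonneg_left (i1.trans i2) hM₂0)
            (mul_le_mul_of_nonneg_left i3 hM₂0)
      _ ≤ M₂ * (3 * B * (2 + L)) + M₂ * (3 * B * (2 + L)) :=
          add_le_add (mul_le_mul_of_nonneg_left (mul_le_mul_of_nonneg_left l1 (by positivity)) hM₂0)
            (mul_le_mul_of_nonneg_left (mul_le_mul_of_nonneg_left l2 (by positivity)) hM₂0)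
      _ = 6 * M₂ * B * (2 + L) := by ring
  -- ### assemble
  rw [← integral_add_compl (measurableSet_ball (x := (0 : EuclideanSpace ℝ (Fin 3))) (ε := s)) hint]
  calc (∫ z in ball (0 : EuclideanSpace ℝ (Fin 3)) s, ‖K (z + d) - K z‖) +
        ∫ z in (ball (0 : EuclideanSpace ℝ (Fin 3)) s)ᶜ, ‖K (z + d) - K z‖
      ≤ 6 * M₂ * B * (2 + L) + 48 * M₃ * B := add_le_add hnear hfar
    _ ≤ (48 * M₃ * B + 12 * M₂ * B) * (1 + L) := by
        have h1 : 0 ≤ M₂ * B := mul_nonneg hM₂0 hB0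
        have h2 : 0 ≤ M₃ * B := mul_nonneg hM₃0 hB0
        nlinarith

end RieszPressureModConst

/-! ### Logarithmic growth of the far potential and of `Q̃` -/

section Growth

open RieszPressureModConst

-- nested operator types `ℝ³ →L[ℝ] ℝ³ →L[ℝ] ℝ³ →L[ℝ] ℝ`
set_option maxSynthPendingDepth 3

variable {r₀ r₁ : ℝ}

/-- **Logarithmic growth of the renormalised far potential**: there is `A ≥ 0` (cutoff radii
only) with `|farPotentialMod r₀ r₁ x' v x| ≤ A N² (1 + log(1 + |x − x'|))` for all bounded
continuous `v` (`|v| ≤ N`) — the `log` translation modulus of `D²Γ∞` (Seregin 2014, Lemma 6.5: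
`‖q_F‖_BMO ≤ c ‖F‖_∞`). [cite: Seregin2014, §6.2 Lemma 6.5] -/
theorem exists_abs_farPotentialMod_le_log (h₀ : 0 < r₀) (h₁ : r₀ < r₁) :
    ∃ A, 0 ≤ A ∧ ∀ (v : EuclideanSpace ℝ (Fin 3) → EuclideanSpace ℝ (Fin 3)) (N : ℝ),
      (∀ y, ‖v y‖ ≤ N) → ∀ x x' : EuclideanSpace ℝ (Fin 3),
      |farPotentialMod r₀ r₁ x' v x| ≤ A * N ^ 2 * (1 + Real.log (1 + ‖x - x'‖)) := by
  obtain ⟨A, hA0, hA⟩ := exists_integral_norm_fderiv2_newtonFar_translate_sub_le_log h₀ h₁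
  refine ⟨A, hA0, fun v N hN x x' => ?_⟩
  calc |farPotentialMod r₀ r₁ x' v x| ≤ N ^ 2 * ∫ z, ‖fderiv ℝ (fderiv ℝ (newtonFar r₀ r₁)) (z + (x - x')) -
        fderiv ℝ (fderiv ℝ (newtonFar r₀ r₁)) z‖ := abs_farPotentialMod_le_modulus h₀ h₁ hN x x'
    _ ≤ N ^ 2 * (A * (1 + Real.log (1 + ‖x - x'‖))) :=
        mul_le_mul_of_nonneg_left (hA (x - x')) (sq_nonneg N)
    _ = A * N ^ 2 * (1 + Real.log (1 + ‖x - x'‖)) := by ring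

/-- **Logarithmic growth of the Riesz pressure modulo constants**: there is `A ≥ 0` such that
for every bounded continuous field (`|v| ≤ N`) with bounded source (`|G[v]| ≤ N_G`), every base
point `x₀` and all `x, x'`:
`|Q̃(x) − Q̃(x')| ≤ 2 N_G ∫|Γ₀| + A N² (1 + log(1+|x−x'|))` — the quantitative form of
`p_{u⊗u} ∈ BMO` for bounded `u` (Seregin 2014, Lemma 6.5; Def. 6.3: the pressure of a mild
bounded ancient solution). [cite: Seregin2014, §6.2 Lemma 6.5] -/
theorem exists_abs_pressurePotentialMod_sub_le_log :
    ∃ A, 0 ≤ A ∧ ∀ (v : EuclideanSpace ℝ (Fin 3) → EuclideanSpace ℝ (Fin 3)), Continuous v →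
      ∀ N NG : ℝ, (∀ y, ‖v y‖ ≤ N) → (∀ y, |pressureSource v y| ≤ NG) →
      ∀ x₀ x x' : EuclideanSpace ℝ (Fin 3),
      |pressurePotentialMod x₀ v x - pressurePotentialMod x₀ v x'| ≤
        2 * NG * (∫ z, |newtonNear 1 2 z|) + A * N ^ 2 * (1 + Real.log (1 + ‖x - x'‖)) := by
  obtain ⟨A, hA0, hA⟩ := exists_abs_farPotentialMod_le_log one_pos one_lt_two
  refine ⟨A, hA0, fun v hv N NG hN hG x₀ x x' => ?_⟩
  have h1 := abs_nearPotential_le zero_le_one one_lt_two hG x (v := v)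
  have h2 := abs_nearPotential_le zero_le_one one_lt_two hG x' (v := v)
  have h3 := hA v N hN x x'
  have e : pressurePotentialMod x₀ v x - pressurePotentialMod x₀ v x' =
      -(nearPotential 1 2 v x - nearPotential 1 2 v x') -
        (farPotentialMod 1 2 x₀ v x - farPotentialMod 1 2 x₀ v x') := by
    unfold pressurePotentialMod; ring
  rw [e, farPotentialMod_sub_farPotentialMod one_pos one_lt_two hv hN]
  calc |-(nearPotential 1 2 v x - nearPotential 1 2 v x') - farPotentialMod 1 2 x' v x|
      ≤ |-(nearPotential 1 2 v x - nearPotential 1 2 v x')| + |farPotentialMod 1 2 x' v x| :=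
        abs_sub _ _
    _ ≤ (|nearPotential 1 2 v x| + |nearPotential 1 2 v x'|) + |farPotentialMod 1 2 x' v x| := by
        gcongr
        rw [abs_neg]
        exact abs_sub _ _
    _ ≤ (NG * (∫ z, |newtonNear 1 2 z|) + NG * (∫ z, |newtonNear 1 2 z|)) +
          A * N ^ 2 * (1 + Real.log (1 + ‖x - x'‖)) := by gcongr
    _ = 2 * NG * (∫ z, |newtonNear 1 2 z|) + A * N ^ 2 * (1 + Real.log (1 + ‖x - x'‖)) := by ring

end Growth

end Literature.Analysis.FluidPDE

end
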